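import Literature.NumberTheory.Rogawski1990.SingularFrameBlockTransport       -- ★ FILE 1 (F0P3a-p08): block-diagonal Gram of a matched frame, unitary frame transport, never-both (generic), rank-1 bookkeeping
import Literature.NumberTheory.Automorphic.QuadraticLocalNormGroupNonsplit     -- ★ local norm index two: `exists_norm_mul_of_not_exists_norm`
import HarnessLib

/-!
# The norm fibre at a `(G,H)`-regular singular pair: WITT DICHOTOMY over `E_v` — every matched regular class is unitarily conjugate into the frame of `ε` or of `ε′`,
# never both (Rogawski 1990, §3.8 Prop. 3.8.1 (d); §8.1, proof of Prop. 8.1.3)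

Topic `NumberTheory/Rogawski1990`; namespace `Literature.NumberTheory.Rogawski1990`.  THEOREMS ONLY (no definition, no instance, no notation, no named fact,
no `sorry`).  Cell `pub/hodgecm-mathlib` (D-0151), crux H413 = stmt-HodgeConjecture-24833, F0∕P3a road «D-N6-ns», floor-2 line «N6nsGerm» (tree
`Cruxes/H413/Lines/F0_P3a_N6nsGerm.lean`), stub `stub_N6nsS1`; brick **B3-alg** (FILE 2 of 2) of the (α′) junction `LocalTransferCentralSingularJunctionCM` (F0P2-p02 (g8)
census a69e3f7c → v2, LEAD F0P3a-plan (g9) WORD T8-63 (B), T8-65 (2)); seat F0P3a-p08 (g13).  HONEST LABEL: HC_CM is proved only modulo the printed citations until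
rung 0 closes; this file is unconditional local linear algebra and proves no letter.

THE MATHEMATICS.  `ε₀ = ι(a·1₂, u)` is singular semisimple and `(G,H)`-regular (`a ≠ u`); its stable class in `G′_v = U(H′)(L⁺_v)` (non-split `v`) consists of TWO classes
`ε`, `ε′`, realised by frames `P`, `P′` (`ε P = P (a·1₂ ⊕ᶠ u)`) whose Gram blocks `ᵗ(σP) H P = G₁ ⊕ᶠ G₂`, `ᵗ(σP′) H P′ = G₁′ ⊕ᶠ G₂′` have rank-2 determinants in the two
DIFFERENT classes of `F_v^× ∕ N E_v^×` [Rogawski1990, 3.8.1 (d)] (★ `SingularLocalConjugacy.exists_unitary_conj_of_det_blocks`).  For a unitary `γ` with a frame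
`γ Q = Q (B₀ ⊕ᶠ l·1)` (`σ(l) l = 1`, `χ_{B₀}(l)` a unit — the frame handed over by a matched `G`-regular `γ_H = (A, b)`: `Q := y`, `B₀ := A`, `l := b`), ★ FILE 1 makes
`ᵗ(σQ) H Q = Γ₁ ⊕ᶠ Γ₂`; the rank-2 determinant class of `Γ₁` agrees with that of `G₁` or with that of `G₁′` (LOCAL NORM INDEX TWO, ★ `exists_norm_mul_of_not_exists_norm`),
the rank-2 congruence is ★ `exists_formCongr_eq_of_det_eq_mul_norm`, the rank-1 one is bookkeeping, and ★ FILE 1's frame transport yields a UNITARY `x` with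
`(x γ x⁻¹) P = P (B ⊕ᶠ l·1)` — or the same with `P′`: **`exists_unitary_conj_frame_or`**.  NEVER BOTH (**`not_frame_and_frame`**): ★ FILE 1's
`exists_det_eq_norm_mul_of_frames` would identify the two rank-2 classes.  This is the algebraic form of the «sided uniform fibre» of Harish-Chandra's descent at `ε₀`
(binder B3 of the junction): with an `Ad(Z(ε))`-invariant descent neighbourhood no saturation statement is needed (bus 2026-09-01 04:53–04:58Z, F0P3a-p08 ∕ A-p16 ∕ F0P2-p02).

## References
* [Rogawski1990] J. D. Rogawski, *Automorphic Representations of Unitary Groups in Three Variables*, Ann. of Math. Stud. 123 (1990): §3.1 p. 19; §3.8 Prop. 3.8.1 (d) p. 30;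
  §8.1 proof of Prop. 8.1.3 pp. 115–116 (the split of the `κ`-orbital integral near `ε₀` over the classes `ε`, `ε′`).
* [Jacobowitz1962] R. Jacobowitz, *Hermitian forms over local fields*, Amer. J. Math. 84 (1962), §3 Thm. 3.1.
* [Omeara1963] O. T. O'Meara, *Introduction to Quadratic Forms* (1963), §63B Prop. 63:13 (local norm index two).
-/

set_option autoImplicit false

noncomputable section

open NumberField IsDedekindDomain Matrix Polynomial
open scoped MatrixGroups

namespace Literature.NumberTheory.Rogawski1990

open Literature.NumberTheory.Automorphic
open Literature.NumberTheory.Automorphic.UnitaryGroup (finSum finSum_map det_finSum transpose_finSum_map)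
open Literature.AlgebraicGeometry.ShimuraVarieties (unitaryGroup)

section GenericHelpers

variable {S : Type*} [CommRing S] (σ : S →+* S) {N₁ N₂ : ℕ}

/-- `⊕ᶠ` is injective in the pair of blocks. [folklore] -/
private theorem finSum_inj₄ {A C : Matrix (Fin N₁) (Fin N₁) S} {B D : Matrix (Fin N₂) (Fin N₂) S}
    (h : finSum N₁ N₂ A B = finSum N₁ N₂ C D) : A = C ∧ B = D := by
  have h' := (Matrix.reindex finSumFinEquiv finSumFinEquiv).injective h
  rw [Matrix.fromBlocks_inj] at h'
  exact ⟨h'.1, h'.2.2.2⟩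

/-- Determinants of `σ`-hermitian matrices are `σ`-fixed. [folklore] -/
private theorem conj_det_of_conjTranspose_eq' {n : ℕ} {G : Matrix (Fin n) (Fin n) S} (hG : (G.map σ)ᵀ = G) : σ G.det = G.det := by
  conv_rhs => rw [← hG]
  rw [Matrix.det_transpose, ← RingHom.mapMatrix_apply, ← RingHom.map_det]

/-- If a unit `g` is `σ`-fixed then so is `g⁻¹`. [folklore] -/
private theorem conj_units_inv_of_conj_eq' {g : Sˣ} (hg : σ g = g) : σ ((g⁻¹ : Sˣ) : S) = ((g⁻¹ : Sˣ) : S) := by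
  have h : σ (g : S) * σ ((g⁻¹ : Sˣ) : S) = 1 := by rw [← map_mul, Units.mul_inv, map_one]
  rw [hg] at h
  calc σ ((g⁻¹ : Sˣ) : S) = ((g⁻¹ : Sˣ) : S) * ((g : S) * σ ((g⁻¹ : Sˣ) : S)) := by rw [← mul_assoc, Units.inv_mul, one_mul]
    _ = ((g⁻¹ : Sˣ) : S) := by rw [h, mul_one]

/-- Norm classes are symmetric: `a′ = a·N(z)` ⇒ `a = a′·N(z⁻¹)`. [folklore] -/
private theorem exists_eq_mul_norm_symm' {a a' : S} (h : ∃ z : S, IsUnit z ∧ a' = a * (σ z * z)) : ∃ z : S, IsUnit z ∧ a = a' * (σ z * z) := by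
  obtain ⟨z, ⟨zu, rfl⟩, h⟩ := h
  refine ⟨((zu⁻¹ : Sˣ) : S), (zu⁻¹).isUnit, ?_⟩
  rw [h]
  calc a = a * (σ ((zu : S) * ((zu⁻¹ : Sˣ) : S)) * ((zu : S) * ((zu⁻¹ : Sˣ) : S))) := by rw [Units.mul_inv, map_one, one_mul, mul_one]
    _ = a * (σ (zu : S) * (zu : S)) * (σ ((zu⁻¹ : Sˣ) : S) * ((zu⁻¹ : Sˣ) : S)) := by rw [map_mul]; ring

end GenericHelpers

/-! ## §2 Over `E_v` at a non-split place: the dichotomy by the rank-2 determinant class, and never both -/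

section Local

open Literature.NumberTheory.Automorphic.UnitaryGroup

variable {F : Type} (E : Type) [Field F] [NumberField F] [Field E] [NumberField E] [Algebra F E]
  [Algebra.IsQuadraticExtension F E] (v : HeightOneSpectrum (𝓞 F)) (c : E ≃ₐ[F] E) {δ : E} (hcδ : c δ = -δ) (hδ : δ ≠ 0)

include hcδ hδ in
/-- **ONE SIDE**: if the frame `Q` of `γ` has block-diagonal Gram matrix `Γ₁ ⊕ᶠ Γ₂` (`twistGram_eq_finSum_of_frame_unitary`) whose rank-2 class agrees with that of the frame `R`, a UNITARY conjugate of `γ` is `R (B ⊕ᶠ l·1) R⁻¹` (★ rank-2 congruence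
by the determinant class, rank-1 by bookkeeping, then `exists_unitary_frame_transport`). [cite: Rogawski1990, §3.8 Prop. 3.8.1 (d) p. 30] [cite: Jacobowitz1962, §3 Thm. 3.1] -/
theorem exists_unitary_conj_frame_of_det_eq_mul_norm (w : PlacesOver E v) (hw : c • w.1 = w.1)
    {H : Matrix (Fin (2 + 1)) (Fin (2 + 1)) (LocalRing E v)} (hH : (H.map (conjLocal E c v))ᵀ = H) (hHd : IsUnit H.det)
    {R : GL (Fin (2 + 1)) (LocalRing E v)} {K₁ : Matrix (Fin 2) (Fin 2) (LocalRing E v)} {K₂ : Matrix (Fin 1) (Fin 1) (LocalRing E v)}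
    (hR : twistGram (conjLocal E c v) H R.val = finSum 2 1 K₁ K₂)
    {γ Q : GL (Fin (2 + 1)) (LocalRing E v)} {B₀ : Matrix (Fin 2) (Fin 2) (LocalRing E v)} {l : LocalRing E v}
    (hQ : γ.val * Q.val = Q.val * finSum 2 1 B₀ (l • (1 : Matrix (Fin 1) (Fin 1) (LocalRing E v))))
    {Γ₁ : Matrix (Fin 2) (Fin 2) (LocalRing E v)} {Γ₂ : Matrix (Fin 1) (Fin 1) (LocalRing E v)}
    (hQΓ : twistGram (conjLocal E c v) H Q.val = finSum 2 1 Γ₁ Γ₂)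
    (hdet : ∃ z : LocalRing E v, IsUnit z ∧ Γ₁.det = K₁.det * (conjLocal E c v z * z)) :
    ∃ x : GL (Fin (2 + 1)) (LocalRing E v), x ∈ unitaryGroup (conjLocal E c v) H ∧ ∃ B : Matrix (Fin 2) (Fin 2) (LocalRing E v),
      (x * γ * x⁻¹).val * R.val = R.val * finSum 2 1 B (l • (1 : Matrix (Fin 1) (Fin 1) (LocalRing E v))) := by
  have hσ : ∀ x, conjLocal E c v (conjLocal E c v x) = x := Liu2021.LemD1OfPlace.conjLocal_conjLocal_apply E v c hcδ hδ
  have hRG : ((twistGram (conjLocal E c v) H R.val).map (conjLocal E c v))ᵀ = twistGram (conjLocal E c v) H R.val := conjTranspose_twistGram _ _ hσ hH _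
  have hQG : ((twistGram (conjLocal E c v) H Q.val).map (conjLocal E c v))ᵀ = twistGram (conjLocal E c v) H Q.val := conjTranspose_twistGram _ _ hσ hH _
  rw [hR, transpose_finSum_map] at hRG
  rw [hQΓ, transpose_finSum_map] at hQG
  obtain ⟨hK₁h, -⟩ := finSum_inj₄ hRG
  obtain ⟨hΓ₁h, -⟩ := finSum_inj₄ hQG
  have hdR : K₁.det * K₂.det = conjLocal E c v R.val.det * H.det * R.val.det := by rw [← det_finSum, ← hR, det_twistGram]
  have hdQ : Γ₁.det * Γ₂.det = conjLocal E c v Q.val.det * H.det * Q.val.det := by rw [← det_finSum, ← hQΓ, det_twistGram]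
  have hRd : IsUnit R.val.det := Matrix.isUnits_det_units R
  have hQd : IsUnit Q.val.det := Matrix.isUnits_det_units Q
  have hK₁d : IsUnit K₁.det := isUnit_of_mul_isUnit_left (hdR ▸ ((hRd.map (conjLocal E c v)).mul hHd).mul hRd)
  have hΓ₁d : IsUnit Γ₁.det := isUnit_of_mul_isUnit_left (hdQ ▸ ((hQd.map (conjLocal E c v)).mul hHd).mul hQd)
  obtain ⟨t₁, ht₁⟩ := exists_formCongr_eq_of_det_eq_mul_norm E v c hcδ hδ w hw hK₁h hΓ₁h hK₁d hΓ₁d hdet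
  obtain ⟨z₂, hz₂U, hz₂⟩ := exists_rank_one_eq_norm_smul (conjLocal E c v) hdR hdQ hRd hQd hK₁d hdet
  obtain ⟨zu₂, rfl⟩ := hz₂U
  obtain ⟨x, hx, hxR⟩ := exists_unitary_frame_transport (conjLocal E c v) H hR hQΓ t₁ (by rw [twistGram_def]; exact ht₁)
    ⟨(zu₂ : LocalRing E v) • (1 : Matrix (Fin 1) (Fin 1) (LocalRing E v)), ((zu₂⁻¹ : (LocalRing E v)ˣ) : LocalRing E v) • (1 : Matrix (Fin 1) (Fin 1) (LocalRing E v)),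
      by rw [Matrix.smul_mul, Matrix.one_mul, smul_smul, Units.mul_inv, one_smul],
      by rw [Matrix.smul_mul, Matrix.one_mul, smul_smul, Units.inv_mul, one_smul]⟩
    (by
      change twistGram (conjLocal E c v) K₂ ((zu₂ : LocalRing E v) • (1 : Matrix (Fin 1) (Fin 1) (LocalRing E v))) = Γ₂
      rw [twistGram_def, Matrix.map_smul' _ _ _ (map_mul _), Matrix.map_one _ (map_zero _) (map_one _), Matrix.transpose_smul, Matrix.transpose_one,
        Matrix.smul_mul, Matrix.one_mul, Matrix.mul_smul, Matrix.mul_one, smul_smul, mul_comm, hz₂])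
    hQ
  exact ⟨x, hx, _, hxR⟩

include hcδ hδ in
/-- **THE DICHOTOMY (block splitting + Witt by the determinant class).**  `H` hermitian invertible over `E_v` (`v` non-split), frames `P`, `P′` with block-diagonal
Gram matrices `G₁ ⊕ᶠ G₂`, `G₁′ ⊕ᶠ G₂′` whose rank-2 determinant classes DIFFER (`¬ det G₁′ ≡ det G₁ mod N(E_vˣ)` — the two classes `ε`, `ε′` of the stable class of
`a·1₂ ⊕ᶠ u`, ★ `exists_unitary_conj_of_det_blocks`), and a unitary `γ` with a frame `γ Q = Q (B₀ ⊕ᶠ l·1)`, `σ(l) l = 1`, `χ_{B₀}(l)` a unit.  Then some UNITARY conjugate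
of `γ` is `P (B ⊕ᶠ l·1) P⁻¹`, or some unitary conjugate is `P′ (B ⊕ᶠ l·1) P′⁻¹` (local norm index two decides which).
[cite: Rogawski1990, §3.8 Prop. 3.8.1 (d) p. 30; §8.1 pp. 115–116] [cite: Jacobowitz1962, §3 Thm. 3.1] [cite: Omeara1963, §63B Prop. 63:13] -/
theorem exists_unitary_conj_frame_or (w : PlacesOver E v) (hw : c • w.1 = w.1)
    {H : Matrix (Fin (2 + 1)) (Fin (2 + 1)) (LocalRing E v)} (hH : (H.map (conjLocal E c v))ᵀ = H) (hHd : IsUnit H.det)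
    {P P' : GL (Fin (2 + 1)) (LocalRing E v)} {G₁ G₁' : Matrix (Fin 2) (Fin 2) (LocalRing E v)} {G₂ G₂' : Matrix (Fin 1) (Fin 1) (LocalRing E v)}
    (hP : twistGram (conjLocal E c v) H P.val = finSum 2 1 G₁ G₂) (hP' : twistGram (conjLocal E c v) H P'.val = finSum 2 1 G₁' G₂')
    (hnn : ¬ ∃ z : LocalRing E v, IsUnit z ∧ G₁'.det = G₁.det * (conjLocal E c v z * z))
    {γ Q : GL (Fin (2 + 1)) (LocalRing E v)} (hγ : γ ∈ unitaryGroup (conjLocal E c v) H) {B₀ : Matrix (Fin 2) (Fin 2) (LocalRing E v)} {l : LocalRing E v}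
    (hQ : γ.val * Q.val = Q.val * finSum 2 1 B₀ (l • (1 : Matrix (Fin 1) (Fin 1) (LocalRing E v)))) (hl : conjLocal E c v l * l = 1)
    (hχ : IsUnit (B₀.charpoly.eval l)) :
    (∃ x : GL (Fin (2 + 1)) (LocalRing E v), x ∈ unitaryGroup (conjLocal E c v) H ∧ ∃ B : Matrix (Fin 2) (Fin 2) (LocalRing E v),
        (x * γ * x⁻¹).val * P.val = P.val * finSum 2 1 B (l • (1 : Matrix (Fin 1) (Fin 1) (LocalRing E v)))) ∨
      (∃ x : GL (Fin (2 + 1)) (LocalRing E v), x ∈ unitaryGroup (conjLocal E c v) H ∧ ∃ B : Matrix (Fin 2) (Fin 2) (LocalRing E v),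
        (x * γ * x⁻¹).val * P'.val = P'.val * finSum 2 1 B (l • (1 : Matrix (Fin 1) (Fin 1) (LocalRing E v)))) := by
  have hσ : ∀ x, conjLocal E c v (conjLocal E c v x) = x := Liu2021.LemD1OfPlace.conjLocal_conjLocal_apply E v c hcδ hδ
  obtain ⟨Γ₁, Γ₂, hQΓ⟩ := twistGram_eq_finSum_of_frame_unitary (conjLocal E c v) H hγ hQ hl hχ
  -- hermitian blocks with unit determinants
  have hPG : ((twistGram (conjLocal E c v) H P.val).map (conjLocal E c v))ᵀ = twistGram (conjLocal E c v) H P.val := conjTranspose_twistGram _ _ hσ hH _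
  have hP'G : ((twistGram (conjLocal E c v) H P'.val).map (conjLocal E c v))ᵀ = twistGram (conjLocal E c v) H P'.val := conjTranspose_twistGram _ _ hσ hH _
  have hQG : ((twistGram (conjLocal E c v) H Q.val).map (conjLocal E c v))ᵀ = twistGram (conjLocal E c v) H Q.val := conjTranspose_twistGram _ _ hσ hH _
  rw [hP, transpose_finSum_map] at hPG
  rw [hP', transpose_finSum_map] at hP'G
  rw [hQΓ, transpose_finSum_map] at hQG
  obtain ⟨hG₁h, -⟩ := finSum_inj₄ hPG
  obtain ⟨hG₁'h, -⟩ := finSum_inj₄ hP'G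
  obtain ⟨hΓ₁h, -⟩ := finSum_inj₄ hQG
  have hdP : G₁.det * G₂.det = conjLocal E c v P.val.det * H.det * P.val.det := by rw [← det_finSum, ← hP, det_twistGram]
  have hdP' : G₁'.det * G₂'.det = conjLocal E c v P'.val.det * H.det * P'.val.det := by rw [← det_finSum, ← hP', det_twistGram]
  have hdQ : Γ₁.det * Γ₂.det = conjLocal E c v Q.val.det * H.det * Q.val.det := by rw [← det_finSum, ← hQΓ, det_twistGram]
  have hPd : IsUnit P.val.det := Matrix.isUnits_det_units P
  have hP'd : IsUnit P'.val.det := Matrix.isUnits_det_units P'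
  have hQd : IsUnit Q.val.det := Matrix.isUnits_det_units Q
  obtain ⟨g₁, hg₁⟩ : IsUnit G₁.det := isUnit_of_mul_isUnit_left (hdP ▸ ((hPd.map (conjLocal E c v)).mul hHd).mul hPd)
  obtain ⟨g₁', hg₁'⟩ : IsUnit G₁'.det := isUnit_of_mul_isUnit_left (hdP' ▸ ((hP'd.map (conjLocal E c v)).mul hHd).mul hP'd)
  have hΓ₁d : IsUnit Γ₁.det := isUnit_of_mul_isUnit_left (hdQ ▸ ((hQd.map (conjLocal E c v)).mul hHd).mul hQd)
  have hσg₁ : conjLocal E c v (g₁ : LocalRing E v) = g₁ := by rw [hg₁]; exact conj_det_of_conjTranspose_eq' _ hG₁h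
  have hσg₁' : conjLocal E c v (g₁' : LocalRing E v) = g₁' := by rw [hg₁']; exact conj_det_of_conjTranspose_eq' _ hG₁'h
  have hg₁i : (g₁ : LocalRing E v) * ((g₁⁻¹ : (LocalRing E v)ˣ) : LocalRing E v) = 1 := g₁.mul_inv
  have hg₁'i : (g₁' : LocalRing E v) * ((g₁'⁻¹ : (LocalRing E v)ˣ) : LocalRing E v) = 1 := g₁'.mul_inv
  -- the σ-fixed units `r := det Γ₁ ∕ det G₁` and `q := det G₁ ∕ det G₁′`
  set r : LocalRing E v := Γ₁.det * ((g₁⁻¹ : (LocalRing E v)ˣ) : LocalRing E v) with hr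
  set q : LocalRing E v := (g₁ : LocalRing E v) * ((g₁'⁻¹ : (LocalRing E v)ˣ) : LocalRing E v) with hq
  have hrσ : conjLocal E c v r = r := by rw [hr, map_mul, conj_det_of_conjTranspose_eq' _ hΓ₁h, conj_units_inv_of_conj_eq' _ hσg₁]
  have hqσ : conjLocal E c v q = q := by rw [hq, map_mul, hσg₁, conj_units_inv_of_conj_eq' _ hσg₁']
  have hru : IsUnit r := hΓ₁d.mul (g₁⁻¹).isUnit
  have hqu : IsUnit q := g₁.isUnit.mul (g₁'⁻¹).isUnit
  have e1 : Γ₁.det = r * (g₁ : LocalRing E v) := by rw [hr, mul_assoc, Units.inv_mul, mul_one]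
  by_cases hrn : ∃ z : LocalRing E v, IsUnit z ∧ r = conjLocal E c v z * z
  · -- ε-side: `det Γ₁ = det G₁ · N(z)`
    left
    obtain ⟨z, hzU, hz⟩ := hrn
    refine exists_unitary_conj_frame_of_det_eq_mul_norm E v c hcδ hδ w hw hH hHd hP hQ hQΓ ⟨z, hzU, ?_⟩
    rw [e1, hz, hg₁, mul_comm]
  · -- ε′-side: `q` is not a norm either (else the two classes agree), so `q = N(z) r` (index two) and `det Γ₁ = det G₁′ · N(z r)`
    right
    have hqn : ¬ ∃ z : LocalRing E v, IsUnit z ∧ q = conjLocal E c v z * z := by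
      rintro ⟨z, ⟨zu, rfl⟩, hz⟩
      refine hnn ⟨((zu⁻¹ : (LocalRing E v)ˣ) : LocalRing E v), (zu⁻¹).isUnit, ?_⟩
      have hzi : (zu : LocalRing E v) * ((zu⁻¹ : (LocalRing E v)ˣ) : LocalRing E v) = 1 := zu.mul_inv
      have hσzi : conjLocal E c v (zu : LocalRing E v) * conjLocal E c v ((zu⁻¹ : (LocalRing E v)ˣ) : LocalRing E v) = 1 := by rw [← map_mul, hzi, map_one]
      rw [← hg₁, ← hg₁']
      rw [hq] at hz
      linear_combination (-((g₁' : LocalRing E v) * conjLocal E c v ((zu⁻¹ : (LocalRing E v)ˣ) : LocalRing E v) * ((zu⁻¹ : (LocalRing E v)ˣ) : LocalRing E v))) * hz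
        + ((g₁ : LocalRing E v) * conjLocal E c v ((zu⁻¹ : (LocalRing E v)ˣ) : LocalRing E v) * ((zu⁻¹ : (LocalRing E v)ˣ) : LocalRing E v)) * hg₁'i
        + (-((g₁' : LocalRing E v) * (zu : LocalRing E v) * ((zu⁻¹ : (LocalRing E v)ˣ) : LocalRing E v))) * hσzi
        + (-(g₁' : LocalRing E v)) * hzi
    obtain ⟨z, hzU, hz⟩ := exists_norm_mul_of_not_exists_norm E v c hcδ hδ w hw hrσ hru hqσ hqu hrn hqn
    refine exists_unitary_conj_frame_of_det_eq_mul_norm E v c hcδ hδ w hw hH hHd hP' hQ hQΓ ⟨z * r, hzU.mul hru, ?_⟩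
    rw [map_mul, hrσ, ← hg₁', e1]
    rw [hq] at hz
    linear_combination (r * (g₁' : LocalRing E v)) * hz - (r * (g₁ : LocalRing E v)) * hg₁'i

omit [Algebra.IsQuadraticExtension F E] in
/-- **NEVER BOTH.**  With the frame data of `exists_unitary_conj_frame_or` (rank-2 classes of `P`, `P′` different), a unitary `γ` cannot have one unitary conjugate
in the frame of `P` and another in the frame of `P′` with the SAME scalar second block `l` and units `χ_B(l)`, `χ_{B′}(l)`: the intertwining unitary is block
diagonal in the frames (Sylvester) and would identify the two rank-2 classes. [cite: Rogawski1990, §3.8 Prop. 3.8.1 (d) p. 30] [cite: HornJohnson2013, §2.4.4] -/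
theorem not_frame_and_frame {H : Matrix (Fin (2 + 1)) (Fin (2 + 1)) (LocalRing E v)}
    {P P' : GL (Fin (2 + 1)) (LocalRing E v)} {G₁ G₁' : Matrix (Fin 2) (Fin 2) (LocalRing E v)} {G₂ G₂' : Matrix (Fin 1) (Fin 1) (LocalRing E v)}
    (hP : twistGram (conjLocal E c v) H P.val = finSum 2 1 G₁ G₂) (hP' : twistGram (conjLocal E c v) H P'.val = finSum 2 1 G₁' G₂')
    (hnn : ¬ ∃ z : LocalRing E v, IsUnit z ∧ G₁'.det = G₁.det * (conjLocal E c v z * z))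
    {γ x x' : GL (Fin (2 + 1)) (LocalRing E v)} (hx : x ∈ unitaryGroup (conjLocal E c v) H) (hx' : x' ∈ unitaryGroup (conjLocal E c v) H)
    {B B' : Matrix (Fin 2) (Fin 2) (LocalRing E v)} {l : LocalRing E v}
    (hB : (x * γ * x⁻¹).val * P.val = P.val * finSum 2 1 B (l • (1 : Matrix (Fin 1) (Fin 1) (LocalRing E v))))
    (hB' : (x' * γ * x'⁻¹).val * P'.val = P'.val * finSum 2 1 B' (l • (1 : Matrix (Fin 1) (Fin 1) (LocalRing E v))))
    (hχ : IsUnit (B.charpoly.eval l)) (hχ' : IsUnit (B'.charpoly.eval l)) : False := by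
  -- `y := x′ x⁻¹` is unitary and `y (xγx⁻¹) y⁻¹ = x′γx′⁻¹`
  have hy : x' * x⁻¹ ∈ unitaryGroup (conjLocal E c v) H := Subgroup.mul_mem _ hx' (Subgroup.inv_mem _ hx)
  have hym : (x' * x⁻¹) * (x * γ * x⁻¹) * (x' * x⁻¹)⁻¹ = x' * γ * x'⁻¹ := by group
  obtain ⟨z, hzU, hz⟩ := exists_det_eq_norm_mul_of_frames (conjLocal E c v) H hP hP' hB hB' hχ hχ' hy hym
  exact hnn (exists_eq_mul_norm_symm' (conjLocal E c v) ⟨z, hzU, by rw [hz]; ring⟩)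

end Local

end Literature.NumberTheory.Rogawski1990

end
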